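import Literature.MathematicalPhysics.QuantumFieldTheory.Balaban1983to89.Node00.N24GlueStage5C

/-!
# NODE N24 · the K-INDEXED SMALL-COUPLING WINDOW of the rung body from the PRINTED β UPPER BOUND ALONE — for every forward-generated construction,
# hence for every finite-ε datum and at every Stage-5 record (`IsRecordOfRecord₅C`)

TRACK A (YM-PLAN §2d, node N24 of 28), seat `pub-ymgap-dag-n24-a` (-a KNIT-BY-NAME).  EIGHTH N24 module, a NEW importing one (append-only growth).
WHY: the window conjunct of route item stmt-QuantumFields-19183 («the runs enter every small coupling window») is met by ZERO-STEP runs for every datum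
(`Node00.window_of_finiteEpsData`, module `N24Glue` §4 — count-neutral), and the rev-1 restatement keeps a K-INDEXED window (plan D60 §9: «the K ≥ 1 window
stays»).  This module proves the K-indexed window HONESTLY and cheaply: for a construction whose couplings are generated FORWARD by (0.18)∕(0.20)
([Balaban1987RG1] pp. 255–256) from the bare coupling with a history-dependent β-family bounded ABOVE by `β⁺` on the boxes `]0, γ₀]^{k+1}` ([Balaban1987RG1]
p. 264: «uniformly bounded on this interval» — the printed half of the β-window; NO lower bound, NO continuity, NO sign is used), for every `γ ∈ ]0, γ₀]`,
every torus exponent `m` and EVERY number of steps `K`, the bare coupling `g₀ := (γ⁻² + K·max(β⁺,0))^{-1/2}` generates a run with `g_0, …, g_K ∈ ]0, γ]`: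
by (0.20), `1/g_k² = 1/g₀² − Σ_{j<k} β_{j+1}(g_0,…,g_j) ≥ γ⁻² + (K − k)·max(β⁺,0) ≥ γ⁻²` inductively (the prefix stays in the box, so the upper bound applies).
THEOREMS ONLY, def-free, sorry-free, standard axioms.

* §1 `N24_window_allK_of_forwardGenerated` — the statement for any `DagBinding.ForwardGenerated C β` with `FlowStep.BetaUpperH β⁺ γ₀ β`;
  `N24_window_allK_of_betaUpperH` — for every finite-ε datum `D` (its dictionary field `D.fwd`), in `D.βfun` currency.
* §2 `N24_window_allK_of_isRecordOfRecord₅C` — at a `₅C` record; `N24_stabilityB_body₅C_windowK` — N24's rung body at `₅C` with the K-INDEXED window in place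
  of the zero-step one: (B2) by `N24_at_record₅C` and, from the SAME upper box bound `hhi` the glue already takes, «∀ γ ∈ ]0, γ₀], ∀ m K, ∃ g₀ > 0, the run
  `⟨K, m, g₀⟩` of `D.C` stays in `]0, γ]`».

HONEST FRAMING: an elementary flow-side lemma (telescoping (0.20) against an upper bound) + bookkeeping; it does NOT touch endpoint existence ([I] Thm 2,
item 19181: hitting a prescribed `g_K = g` needs continuity and the sign of β — `DagBinding.endpointExistence_of_forwardGenerated`), nor any node; N24 stays a
COMPOSITE — no discharge, no count; finite T⁴ at fixed ε; NOT ℝ⁴ ∕ OS ∕ mass gap ∕ Clay.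
-/

noncomputable section

namespace Literature.MathematicalPhysics.QuantumFieldTheory.Balaban1983to89.Node00

open DagBinding T4Continuum T4DatumAssembly FlowStep FlowStepRuns

/-! ## §1. Forward generation + an upper box bound on β ⇒ in-interval runs of every length -/

section Flow

/-- Elementary: for positive `g`, `γ`, `γ⁻² ≤ g⁻²` gives `g ≤ γ`. [folklore] -/
private theorem N24_le_of_one_div_sq_le {g γ : ℝ} (hg : 0 < g) (hγ : 0 < γ) (h : 1 / γ ^ 2 ≤ 1 / g ^ 2) : g ≤ γ := by
  have h2 : g ^ 2 ≤ γ ^ 2 := (one_div_le_one_div (pow_pos hγ 2) (pow_pos hg 2)).1 h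
  nlinarith [h2, hg, hγ]

/-- **The inductive bound.**  For a forward-generated construction (`DagBinding.ForwardGenerated C β`: `g_0 = g₀` and (0.20) solved forward while its
right side is positive) whose β-family is bounded above by `β⁺` on the boxes `]0, γ₀]^{k+1}`, the run from the bare coupling
`g₀ := solveCoupling (γ⁻² + K·B)`, `B := max β⁺ 0`, `γ ∈ ]0, γ₀]`, satisfies `0 < g_i` and `γ⁻² + (K − i)·B ≤ g_i⁻²` for all `i ≤ k ≤ K` (induction on `k`:
the prefix lies in the box, so `β_{k+1}(g_0, …, g_k) ≤ β⁺ ≤ B`, and (0.20) loses at most `B` per step). [cite: Balaban1987RG1, (0.18)–(0.20) pp.255–256 and p.264 («uniformly bounded»; elementary consequence)] -/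
theorem N24_forwardGenerated_lower_bound (C : B12.Construction) (β : HBeta) (hgen : ForwardGenerated C β) {βup γ₀ γ : ℝ}
    (hhi : BetaUpperH βup γ₀ β) (hγ : 0 < γ) (hγ₀ : γ ≤ γ₀) (m K : ℕ) :
    ∀ k, k ≤ K → ∀ i, i ≤ k →
      0 < (C ⟨K, m, solveCoupling (1 / γ ^ 2 + (K : ℝ) * max βup 0)⟩).flow.g i ∧
        1 / γ ^ 2 + ((K : ℝ) - i) * max βup 0 ≤ 1 / ((C ⟨K, m, solveCoupling (1 / γ ^ 2 + (K : ℝ) * max βup 0)⟩).flow.g i) ^ 2 := by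
  set B : ℝ := max βup 0 with hBdef
  have hB0 : 0 ≤ B := le_max_right _ _
  have hBup : βup ≤ B := le_max_left _ _
  have hγ2 : 0 < 1 / γ ^ 2 := by positivity
  have hy₀ : 0 < 1 / γ ^ 2 + (K : ℝ) * B := by positivity
  set P : B12.RunParams := ⟨K, m, solveCoupling (1 / γ ^ 2 + (K : ℝ) * B)⟩ with hPdef
  intro k
  induction k with
  | zero =>
    intro _ i hi
    obtain rfl : i = 0 := Nat.le_zero.mp hi
    have hg0 : (C P).flow.g 0 = solveCoupling (1 / γ ^ 2 + (K : ℝ) * B) := hgen.1 P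
    refine ⟨by rw [hg0]; exact solveCoupling_pos hy₀, ?_⟩
    rw [hg0, inv_sq_solveCoupling hy₀]
    simp
  | succ k ih =>
    intro hk i hi
    have ih' := ih (Nat.le_of_succ_le hk)
    rcases Nat.lt_or_ge i (k + 1) with hlt | hge
    · exact ih' i (Nat.lt_succ_iff.mp hlt)
    · obtain rfl : i = k + 1 := le_antisymm hi hge
      have hkK : k < K := Nat.lt_of_succ_le hk
      -- the prefix `(g_0, …, g_k)` lies in the box `]0, γ₀]^{k+1}`
      have hpos : ∀ j, j ≤ k → 0 < (C P).flow.g j := fun j hj => (ih' j hj).1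
      have hbox : prefixOf (C P).flow.g k ∈ Box γ₀ k := by
        rw [mem_box]
        intro j
        have hj : (j : ℕ) ≤ k := Nat.lt_succ_iff.mp j.isLt
        refine ⟨hpos j hj, ?_⟩
        have hb := (ih' j hj).2
        have hle : 1 / γ ^ 2 ≤ 1 / ((C P).flow.g j) ^ 2 :=
          le_trans (le_add_of_nonneg_right (mul_nonneg (sub_nonneg.mpr (by exact_mod_cast (hj.trans hkK.le))) hB0)) hb
        exact (N24_le_of_one_div_sq_le (hpos j hj) hγ hle).trans hγ₀
      have hβle : β k (prefixOf (C P).flow.g k) ≤ B := (hhi k _ hbox).trans hBup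
      have hbk := (ih' k le_rfl).2
      -- the right side of (0.20) at step k is bounded below by the next rung of the ladder, hence positive
      have hrhs_ge : 1 / γ ^ 2 + ((K : ℝ) - (k + 1 : ℕ)) * B ≤
          1 / ((C P).flow.g k) ^ 2 - β k (prefixOf (C P).flow.g k) := by
        have : ((K : ℝ) - (k + 1 : ℕ)) * B = ((K : ℝ) - k) * B - B := by push_cast; ring
        rw [this]
        linarith
      have hKk : (0 : ℝ) ≤ (K : ℝ) - (k + 1 : ℕ) := by
        have : (k + 1 : ℕ) ≤ K := hk
        exact sub_nonneg.mpr (by exact_mod_cast this)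
      have hrhs : 0 < 1 / ((C P).flow.g k) ^ 2 - β k (prefixOf (C P).flow.g k) :=
        lt_of_lt_of_le (by positivity) hrhs_ge
      obtain ⟨hposk1, heq⟩ := hgen.2 P k hkK hpos hrhs
      exact ⟨hposk1, by rw [heq]; exact hrhs_ge⟩

/-- **IN-INTERVAL RUNS OF EVERY LENGTH from the β UPPER BOUND ALONE.**  For a forward-generated construction whose β-family is bounded above by `β⁺` on the
boxes `]0, γ₀]^{k+1}` ([Balaban1987RG1] p. 264), every `γ ∈ ]0, γ₀]`, every torus exponent `m` and EVERY `K`: some bare coupling `g₀ > 0` generates a run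
`⟨K, m, g₀⟩` with `g_0, …, g_K ∈ ]0, γ]`.  No lower bound, sign or continuity of β is used (contrast the endpoint half of [I] Thm 2,
`DagBinding.endpointExistence_of_forwardGenerated`). [cite: Balaban1987RG1, (0.18)–(0.20) pp.255–256 and p.264 (elementary consequence of the printed upper bound)] -/
theorem N24_window_allK_of_forwardGenerated (C : B12.Construction) (β : HBeta) (hgen : ForwardGenerated C β) {βup γ₀ γ : ℝ}
    (hhi : BetaUpperH βup γ₀ β) (hγ : 0 < γ) (hγ₀ : γ ≤ γ₀) (m K : ℕ) :
    ∃ g0 : ℝ, 0 < g0 ∧ (C ⟨K, m, g0⟩).flow.InInterval γ K := by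
  have hy₀ : 0 < 1 / γ ^ 2 + (K : ℝ) * max βup 0 := by
    have : 0 ≤ max βup 0 := le_max_right _ _
    positivity
  refine ⟨solveCoupling (1 / γ ^ 2 + (K : ℝ) * max βup 0), solveCoupling_pos hy₀, fun k hk => ?_⟩
  obtain ⟨hpos, hb⟩ := N24_forwardGenerated_lower_bound C β hgen hhi hγ hγ₀ m K k hk k le_rfl
  have hle : 1 / γ ^ 2 ≤ 1 / ((C ⟨K, m, solveCoupling (1 / γ ^ 2 + (K : ℝ) * max βup 0)⟩).flow.g k) ^ 2 :=
    le_trans (le_add_of_nonneg_right (mul_nonneg (sub_nonneg.mpr (by exact_mod_cast hk)) (le_max_right _ _))) hb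
  exact ⟨hpos, N24_le_of_one_div_sq_le hpos hγ hle⟩

/-- **For EVERY finite-ε datum** (`T4Continuum.FiniteEpsData`: its flow is forward-generated by (0.18)∕(0.20) from the bare coupling with its β-family
`D.βfun`, dictionary field `D.fwd`): an upper box bound `FlowStep.BetaUpperH β⁺ γ₀ D.βfun` gives in-interval runs of every length `K` at every torus exponent
`m`, for every `γ ∈ ]0, γ₀]`. [cite: Balaban1987RG1, (0.17)–(0.20) pp.255–256 and p.264 (elementary consequence)] -/
theorem N24_window_allK_of_betaUpperH {F : T4Family} {G : Type*} [GaugeGroup G] [MeasurableSpace G] [HaarData G] (D : FiniteEpsData F G)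
    {βup γ₀ : ℝ} (hhi : BetaUpperH βup γ₀ D.βfun) {γ : ℝ} (hγ : 0 < γ) (hγ₀ : γ ≤ γ₀) (m K : ℕ) :
    ∃ g0 : ℝ, 0 < g0 ∧ (D.C ⟨K, m, g0⟩).flow.InInterval γ K :=
  N24_window_allK_of_forwardGenerated D.C.toB12 D.βfun D.fwd hhi hγ hγ₀ m K

end Flow

/-! ## §2. At the Stage-5 record of record: N24's rung body with the K-indexed window -/

section RecordC

variable {F : T4Family} {N : ℕ} [NeZero N] {D : FiniteEpsData F (SU N)} {w : WorldP}

/-- At a `₅C` record, the glue's own upper box bound `hhi : BetaUpperH w.βup γ₀ D.βfun` yields in-interval runs of EVERY length for every `γ ∈ ]0, γ₀]`.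
[cite: Balaban1987RG1, (0.18)–(0.20) pp.255–256 and p.264 (elementary consequence at the record)] -/
theorem N24_window_allK_of_isRecordOfRecord₅C (_h : IsRecordOfRecord₅C F N D w) {γ₀ : ℝ} (hhi : BetaUpperH w.βup γ₀ D.βfun)
    {γ : ℝ} (hγ : 0 < γ) (hγ₀ : γ ≤ γ₀) (m K : ℕ) :
    ∃ g0 : ℝ, 0 < g0 ∧ (D.C ⟨K, m, g0⟩).flow.InInterval γ K :=
  N24_window_allK_of_betaUpperH D hhi hγ hγ₀ m K

/-- **N24's rung body at a `₅C` record WITH THE K-INDEXED WINDOW**: from the record `h`, `w.γ ≤ γ₀`, the ten open children at the record world and the box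
bounds `w.b ≤ D.βfun ≤ w.βup` on `]0, γ₀]^{k+1}` — (B2) `B16.EndStatementBPrinted D.C` (`N24_at_record₅C`) AND «for every `γ ∈ ]0, γ₀]`, every `m` and EVERY
`K`, some bare coupling `g₀ > 0` gives a run `⟨K, m, g₀⟩` of `D.C` inside `]0, γ]`» (from `hhi` alone, §1).  The honest replacement of the zero-step window of
`N24_stabilityB_body₅C`; count-neutral (N24 composite; the window half is elementary). [cite: Balaban1989LargeFieldII, Thm 1 p.355 + p.391; Balaban1987RG1, (0.18)–(0.20) pp.255–256, (1.22) and p.264 (bookkeeping + elementary window)] -/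
theorem N24_stabilityB_body₅C_windowK (h : IsRecordOfRecord₅C F N D w) {γ₀ : ℝ} (hγ₀ : w.γ ≤ γ₀)
    (h03 : ∀ P : B12.RunParams, Dag.B6_main (leavesP w P)) (h05 : ∀ P : B12.RunParams, Dag.B8_main (leavesP w P))
    (h06 : ∀ P : B12.RunParams, Dag.B9_main (leavesP w P)) (h07 : ∀ P : B12.RunParams, Dag.B11_main (leavesP w P))
    (h08 : ∀ P : B12.RunParams, Dag.B10_main (leavesP w P)) (h09 : ∀ P : B12.RunParams, Dag.B12_main (leavesP w P))
    (h10 : ∀ P : B12.RunParams, Dag.B13_main (leavesP w P)) (h11 : ∀ P : B12.RunParams, Dag.B14_main (leavesP w P))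
    (h12 : ∀ P : B12.RunParams, Dag.B15_main (leavesP w P)) (h13 : ∀ P : B12.RunParams, Dag.B16_main (leavesP w P))
    (hlo : FlowStep.BetaLowerH w.b γ₀ D.βfun) (hhi : FlowStep.BetaUpperH w.βup γ₀ D.βfun) :
    B16.EndStatementBPrinted D.C ∧
      ∀ γ : ℝ, 0 < γ → γ ≤ γ₀ → ∀ m K : ℕ, ∃ g0 : ℝ, 0 < g0 ∧ (D.C ⟨K, m, g0⟩).flow.InInterval γ K :=
  ⟨N24_at_record₅C h hγ₀ h03 h05 h06 h07 h08 h09 h10 h11 h12 h13 hlo hhi,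
    fun _ hγ hγle m K => N24_window_allK_of_betaUpperH D hhi hγ hγle m K⟩

end RecordC

end Literature.MathematicalPhysics.QuantumFieldTheory.Balaban1983to89.Node00

end
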